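import Literature.MathematicalPhysics.QuantumFieldTheory.Balaban1983to89.B8Eq106Local
import Literature.MathematicalPhysics.QuantumFieldTheory.Balaban1983to89.B8Eq1123Concrete

/-!
# `Balaban1983to89.B8Eq1124Local` — T. Bałaban, *Spaces of regular gauge field configurations on a lattice and gauge fixing
# conditions*, Commun. Math. Phys. **99** (1985) 75–102 [Balaban1985RegularSpaces] ("B8"), Sect. E p. 97: «Using the analyticity
# properties of `C′(λ)`» — (208) of [3] «`Q′_j(u₁, λ)` … are analytic functions of `λ`» and the analyticity of the remainder
# `C′_j(u₁, λ) = Q′_j(u₁, λ) − Q′_jλ` of (213)/(1.115) — FOR THE INDUCTIVE `u₁` ON THE BLOCK TOWER, with print's LOCAL (region-wise)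
# hypotheses (concrete `ℤᵈ` carriers, general background)

statement-level skeleton of published theorems with citation tags; proofs where landed; nothing here is a claim about the
Yang–Mills mass gap

PDF held: `paper:balaban1985-cmp99-regular-spaces-gauge-fixing` (journal page = PDF page + 74); pp. 96–97 [PDF 22–23] on the text layer
and p. 88 [PDF 14] as an image (this seat, 2026-08-25); [3] = [Balaban1985Averaging] (207)–(208) p. 50, as quoted and proved at a general
background in `B7Eq208Analytic` (`analyticAt_Qnl_of207`) and used by `B8Eq1123Concrete` (`analyticAt_Cnl_family`).

WHAT IS PRINTED.  p. 97: "Let us take `X₁, X₂` satisfying (1.119) and let us estimate the difference `C′(λ − H′X₁) − C′(λ − H′X₂) = …`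
(1.122) … Using the analyticity properties of `C′(λ)` we can write `⟨(δ/δλ)C′(λ′), λ₀⟩ = (d/dτ)C′(λ′ + τλ₀)|_{τ=0} =
(1/2πi)∮ dτ τ⁻² C′(λ′ + τλ₀)` (1.124)"; [3] p. 50: "It is easy to see that for `α₃, α₄` sufficiently small `log ũ′ʲ`, hence `Q′_j(u₁, λ)`
also, are analytic functions of `λ` … on the space of configurations `λ` … (207)".  B8's `λ`'s live on the REGION-DEPENDENT set
(1.119)/(1.120) (`|Dλ| < α₄(Lʲη)⁻¹ on Ω_j`), not on the one-level (207)-domain of [3].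

WHY THIS FILE.  `B7Eq208Analytic.analyticAt_Qnl_of207` / `B8Eq1123Concrete.analyticAt_Cnl_family` prove the analyticity from GLOBAL data
((52) everywhere, (207) at the single scale `η = L⁻ᵏ` everywhere, `u₁ ∈ Λ_k(U₀, α₃)` everywhere; `B8Eq1123Concrete` READING (b): «NOT
CLAIMED: the region-dependent form on `{Ω_j}`»).  THIS FILE gives the tower-local form needed by the region-dependent Sect. E: for the
inductive `u₁` (= the gauge fixing (104)–(106) of [3] at top level `j` on `Bʲ(y)`, `B8Eq106Local`) and a sitewise-analytic family `λ(t)`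
whose member `λ(t₀)` satisfies (1.77) in the (207)-form ON `Bʲ(y)` ONLY, every `t ↦ Q′_m(u₁, λ(t))(z)` and `t ↦ C′_m(u₁, λ(t))(z)` at the
tower sites is analytic at `t₀` — by the locality of both quantities on the tower (the functions of `t` coincide, for ALL `t`, with
those of the clamped data `U₀ ∘ π`, `λ(t) ∘ π`, `glev(U₀∘π, B|_{Bʲ(y)})`, to which the global theorem applies).

WHAT THIS FILE PROVES (kernel, 0 sorry, theorems only, no `def`; tower `[tlo L y n, thi L y n]` of `B8Ineq130`, `lo = hi = y`).
* §1 `Qnl_congr_tower`, `Cnl_congr_tower` — locality on the tower of `Q′_m(u₁, λ)(z)` (208)/(1.79) and of `C′_m(u₁, λ)(z)` (213)/(1.115)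
  (`B8Eq178Averages.Qnl`, `B8Eq1123Concrete.Cnl`), from `B8Eq1115Concrete.utilG_congr_tower`/`lamAvgG_congr_tower`.
* §2 **`analyticAt_Qnl_local`**, **`analyticAt_Cnl_local`** — for `u₁ = glev … j 0`: analyticity at `t₀` of `t ↦ Q′_m(u₁, λ(t))(z)`,
  `t ↦ C′_m(u₁, λ(t))(z)` at every level-`m` site `z ∈ Bⁿ(y)` (`n + m = j`), for `λ(t)` sitewise analytic at `t₀` on `Bʲ(y)` with `λ(t₀)`
  satisfying `‖λ(t₀)(x)‖ < α₄` at the sites and `‖R(U₀(b))λ(t₀)(b₊) − λ(t₀)(b₋)‖ < α₄L^{−j}` on the bonds of `Bʲ(y)`, `U₀` `G`-valued and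
  regular on `Bʲ(y)`, `|B_b| ≤ b` on `Bʲ(y)`, and the `j`-free smallness of `B7Eq167General` (k = j; `α₃ = 40d·Lʲb`) and of
  `B7Eq208Analytic.eq208_analyticAt_of207`.
* §3 **`analyticAt_Qnl_local_of_axial`**, **`analyticAt_Cnl_local_of_axial`** — the same for any `u₁` with (1.19) on the tower and (1.29)
  at `y` (B8's inductive `u₁`), via `B8Eq106Local.eq106_local`.

READINGS / DECLARED DEVIATIONS: as `B8Eq1123Concrete` ((a) `|·|`, `λ := log u′` with print's `i` absorbed; (d) "analytic" = analytic
along every sitewise-analytic family `t ↦ λ(t)`, `t` in any complex normed space) and `B8Eq1115Concrete` ((1.77) in the (207)-form at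
the scale of `Ω_j`; `ℤᵈ` per level; `G ⊂ U1` averaging-closed; explicit constants); the clamping device is the tree's, not print's.
NOT CLAIMED: (1.123)–(1.125) themselves in region-dependent form (next files), anything of Theorem 4.  Unit `pub-ymgap-dag-n04-b`
(YM Track A, node N05 [B8]), 2026-08-25.  Tree API by name only, nothing restated.
-/

noncomputable section

open NormedSpace Finset

namespace Literature.MathematicalPhysics.QuantumFieldTheory.Balaban1983to89.B8Eq1124Local

open B7Prop1Explicit B7Prop2Explicit B7Prop3Flat B7Prop1Local B7Eq92Concrete B7Eq99Concrete B7Eq84Concrete B7Eq167Flat B7Eq167General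
open B7Eq170Flat (cj cj_apply)
open B7Prop10General (utilG C6 C4G)
open B7Prop9Flat (C5')
open B7Prop5Flat (bondsIn restr)
open B7Eq78Linearization (QprimeIter zdBlocking)
open B7Eq214General (lamAvgG)
open B8Ineq130 (tlo thi inBox_of_le)
open B8Ineq132 (Under)
open B8Ineq172Concrete (glev_congr_tower)
open B8Eq1115Concrete (utilG_congr_tower lamAvgG_congr_tower)
open B8Eq106Local (under_iff_tower eq106_local)
open B8Eq119TwistedAxial (bgT)
open B8Eq178Averages (Qnl Qnl_eq_mlog_utilG qprimeIter_bgT_eq_lamAvgG)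
open B8Eq1123Concrete (Cnl)
open B7Eq208Analytic (analyticAt_Qnl_of207)

-- `Site` alone could resolve to the torus sites of `Setup.lean`; re-export the `ℤ^d` sites of `B7Prop1Explicit`.
export B7Prop1Explicit (Site)

variable {d : ℕ}
variable {𝔸 : Type*} [NormedRing 𝔸] [NormOneClass 𝔸] [NormedAlgebra ℂ 𝔸] [CompleteSpace 𝔸]
variable {L : ℕ} {j : ℕ} {y : Site d} {U₀ U₀' : Site d → Fin d → 𝔸ˣ}

/-! ## §1 Locality of `Q′_m(u₁, λ)` and `C′_m(u₁, λ)` on the tower -/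

omit [NormOneClass 𝔸] in
/-- Locality of `Q′_m(u₁, λ)(z) = log ũ′ᵐ(z)` ((208) of [3] / (1.79)) on the tower: it sees `U₀` on the fine block and `u′`, `u₁` on its
sites only. [cite: Balaban1985RegularSpaces, (1.79) p.90; Balaban1985Averaging, (208) p.50, (178)–(179) p.45] -/
theorem Qnl_congr_tower (hL : 1 ≤ L) (h₀ : AgreeOn (tlo L y j) (thi L y j) U₀ U₀') {u' u'' u₁ u₁' : Site d → 𝔸ˣ}
    (hu' : ∀ x : Site d, tlo L y j ≤ x → x ≤ thi L y j → u' x = u'' x)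
    (hu₁ : ∀ x : Site d, tlo L y j ≤ x → x ≤ thi L y j → u₁ x = u₁' x)
    {m n : ℕ} (hmn : n + m = j) (z : Site d) (hz : tlo L y n ≤ z) (hz' : z ≤ thi L y n) :
    Qnl L U₀ u' u₁ m z = Qnl L U₀' u'' u₁' m z := by
  rw [Qnl_eq_mlog_utilG, Qnl_eq_mlog_utilG, utilG_congr_tower hL h₀ hu' hu₁ m n hmn z hz hz']

omit [NormOneClass 𝔸] in
/-- Locality of the remainder `C′_m(u₁, λ)(z) = Q′_m(u₁, λ)(z) − (Q′_mλ)(z)` ((213) of [3] / (1.115)) on the tower: it sees `U₀` on the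
fine block, `u₁` and `λ` on its sites only. [cite: Balaban1985RegularSpaces, (1.115) p.96; Balaban1985Averaging, (213) p.50] -/
theorem Cnl_congr_tower (hL : 1 ≤ L) (h₀ : AgreeOn (tlo L y j) (thi L y j) U₀ U₀') {u₁ u₁' : Site d → 𝔸ˣ} {lam lam' : Site d → 𝔸}
    (hu₁ : ∀ x : Site d, tlo L y j ≤ x → x ≤ thi L y j → u₁ x = u₁' x)
    (hlam : ∀ x : Site d, tlo L y j ≤ x → x ≤ thi L y j → lam x = lam' x)
    {m n : ℕ} (hmn : n + m = j) (z : Site d) (hz : tlo L y n ≤ z) (hz' : z ≤ thi L y n) :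
    Cnl L U₀ u₁ m lam z = Cnl L U₀' u₁' m lam' z := by
  have hu' : ∀ x : Site d, tlo L y j ≤ x → x ≤ thi L y j → (fun x => expUnit (lam x)) x = (fun x => expUnit (lam' x)) x :=
    fun x hx hx' => by simp only [hlam x hx hx']
  rw [Cnl, Cnl, Qnl_congr_tower hL h₀ hu' hu₁ hmn z hz hz', qprimeIter_bgT_eq_lamAvgG, qprimeIter_bgT_eq_lamAvgG,
    lamAvgG_congr_tower hL h₀ hlam m n hmn z hz hz']

/-! ## §2 Analyticity of `Q′_m(u₁, λ)` and `C′_m(u₁, λ)` along sitewise-analytic families, local hypotheses, `u₁ = glev … j 0` -/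

section Analytic

variable {E : Type*} [NormedAddCommGroup E] [NormedSpace ℂ E]
variable {G : Subgroup 𝔸ˣ} {α₀ α₄ : ℝ} {B : Site d → Fin d → 𝔸} {b : ℝ} {lam : E → Site d → 𝔸} {t₀ : E}

omit [NormOneClass 𝔸] [NormedAlgebra ℂ 𝔸] [CompleteSpace 𝔸] in
/-- The zero extension of the field given on the bonds of a box inherits `|B_b| ≤ b` globally (device). [cite: Balaban1985RegularSpaces, (1.69) p.88] -/
private theorem norm_insCfg_restr_le {lo hi : Site d} (hb : 0 ≤ b)
    (hB : ∀ (x : Site d) (κ : Fin d), InBox lo hi x → InBox lo hi (x + e κ) → ‖B x κ‖ ≤ b) (x : Site d) (κ : Fin d) :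
    ‖insCfg (bondsIn lo hi) (restr (bondsIn lo hi) B) x κ‖ ≤ b := by
  by_cases h : (x, κ) ∈ bondsIn lo hi
  · rw [B7Prop5Flat.insCfg_restr_of_mem _ _ h]
    obtain ⟨hx, hx'⟩ := B7Prop5Flat.mem_bondsIn.mp h
    exact hB x κ hx hx'
  · simp only [insCfg, h, dite_false, norm_zero]
    exact hb

omit [NormOneClass 𝔸] [NormedAlgebra ℂ 𝔸] [CompleteSpace 𝔸] in
/-- (207) for `λ ∘ π` w.r.t. the clamped background from (207) on the bonds of the box (device; cf. `B8Eq1115Concrete`).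
[cite: Balaban1985Averaging, (207) p.50] -/
private theorem h207a_clamp {lo hi : Site d} (hlohi : ∀ i, lo i ≤ hi i) {β : ℝ} (hβ : 0 < β) {μ : Site d → 𝔸}
    (h : ∀ (x : Site d) (κ : Fin d), InBox lo hi x → InBox lo hi (x + e κ) → ‖cj (U₀ x κ) (μ (x + e κ)) - μ x‖ < β)
    (x : Site d) (κ : Fin d) :
    ‖cj (clampCfg lo hi U₀ x κ) (μ (clamp lo hi (x + e κ))) - μ (clamp lo hi x)‖ < β := by
  by_cases hP : lo κ ≤ x κ ∧ x κ < hi κ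
  · have hx := clamp_inBox hlohi x
    have hxe : InBox lo hi (clamp lo hi x + e κ) := by rw [← clamp_add_e_of hP]; exact clamp_inBox hlohi _
    simp only [clampCfg, hP, and_self, if_true, clamp_add_e_of hP]
    exact h _ κ hx hxe
  · simp only [clampCfg, hP, if_false, clamp_add_e_of_not (hlohi κ) hP, cj_apply, Units.val_one, inv_one, one_mul,
      mul_one, sub_self, norm_zero]
    exact hβ

/-- **(208) OF [3] ON THE TOWER, LOCAL HYPOTHESES** («`Q′_j(u₁, λ)` … are analytic functions of `λ`», for B8's region-wise data): for
`u₁ = glev … j 0` (gauge fixing of `U₁ = e^{B}` at top level `j`), a family `λ(t)` sitewise analytic at `t₀` on `Bʲ(y)` with `λ(t₀)` in the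
(207)-form of (1.77) ON `Bʲ(y)` (`‖λ(t₀)(x)‖ < α₄`, `‖R(U₀(b))λ(t₀)(b₊) − λ(t₀)(b₋)‖ < α₄L^{−j}`), `U₀` `G`-valued and regular on `Bʲ(y)`,
`|B_b| ≤ b` on `Bʲ(y)`, and the displayed `j`-free smallness: at every level-`m` site `z ∈ Bⁿ(y)` (`n + m = j`),
`t ↦ Q′_m(u₁, λ(t))(z)` is analytic at `t₀`. [cite: Balaban1985RegularSpaces, (1.124) p.97, (1.77) p.90; Balaban1985Averaging, (207)–(208) p.50] -/
theorem analyticAt_Qnl_local (hL : 2 ≤ L) (hG : AvgClosed d L G) (hU₀ : ∀ x κ, U₀ x κ ∈ G)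
    (hα : 0 < α₀) (hα3 : C0 d * α₀ ≤ 1 / 3) (hα4 : 4 * α₀ ≤ c2' d L)
    (h33 : pdevOn (tlo L y j) (thi L y j) U₀ < α₀ * (((L : ℝ) ^ j)⁻¹) ^ 2) (hb : 0 ≤ b)
    (h69 : ∀ (x : Site d) (κ : Fin d), InBox (tlo L y j) (thi L y j) x → InBox (tlo L y j) (thi L y j) (x + e κ) → ‖B x κ‖ ≤ b)
    (hsmall : Real.exp (4 * (800 * ((d : ℝ) + 1) ^ 2 * ((d : ℝ) + 4)) * α₀)
      * (1 + 8 * (131072 * ((d : ℝ) + 1) ^ 2) * ((L : ℝ) ^ j * b)) ≤ 2)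
    (hc₃ : 2 * ((L : ℝ) ^ j * b) ≤ c3 d L) (hs : 128 * (d : ℝ) * ((L : ℝ) ^ j * b) ≤ 1) (hL1 : 1 ≤ L)
    (hlam : ∀ x : Site d, InBox (tlo L y j) (thi L y j) x → AnalyticAt ℂ (fun t => lam t x) t₀)
    (hα₄ : 0 < α₄) (h177b : ∀ x : Site d, InBox (tlo L y j) (thi L y j) x → ‖lam t₀ x‖ < α₄)
    (h177a : ∀ (x : Site d) (κ : Fin d), InBox (tlo L y j) (thi L y j) x → InBox (tlo L y j) (thi L y j) (x + e κ) →
      ‖cj (U₀ x κ) (lam t₀ (x + e κ)) - lam t₀ x‖ < α₄ * ((L : ℝ) ^ j)⁻¹)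
    (hα₃' : 40 * d * ((L : ℝ) ^ j * b) ≤ 1 / 50)
    (hs₁ : 40 * C6 d * α₄ ≤ 1) (hs₂ : 12000 * ((d : ℝ) + 1) * L * α₄ ≤ 1)
    (hs₃ : C4G d L * (α₀ + 40 * d * ((L : ℝ) ^ j * b) + 4 * α₄) ≤ 1)
    (hs₄ : 1024 * ((d : ℝ) + 1) * ((d : ℝ) + 4) * L ^ 2 * α₀ ≤ 1) (hs₅ : 32 * ((d : ℝ) + 1) ^ 2 * C6 d * L ^ 2 * α₀ ≤ 1)
    (hs₆ : 16 * d * C5' d * C6 d * (L : ℝ) ^ 2 * α₀ ≤ 1)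
    {m n : ℕ} (hmn : n + m = j) (z : Site d) (hz : tlo L y n ≤ z) (hz' : z ≤ thi L y n) :
    AnalyticAt ℂ (fun t => Qnl L U₀ (fun x => expUnit (lam t x)) (glev L hL1 U₀ (expCfg B) j 0) m z) t₀ := by
  have hlohi : ∀ i, tlo L y j i ≤ thi L y j i := B8Ineq130.tlo_le_thi hL1 le_rfl j
  have hUU : ∀ x κ, U₀ x κ ∈ U1 𝔸 := fun x κ => hG.le_U1 (hU₀ x κ)
  -- the extended data
  set U₀c := clampCfg (tlo L y j) (thi L y j) U₀ with hU₀c_def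
  set Bc := insCfg (bondsIn (tlo L y j) (thi L y j)) (restr (bondsIn (tlo L y j) (thi L y j)) B) with hBc_def
  set lamc : E → Site d → 𝔸 := fun t x => lam t (clamp (tlo L y j) (thi L y j) x) with hlamc_def
  have hU₀c : ∀ x κ, U₀c x κ ∈ G := clampCfg_mem hU₀
  have h52c : pdev U₀c < α₀ * (((L : ℝ) ^ j)⁻¹) ^ 2 := (pdev_clampCfg_le hlohi hUU).trans_lt h33
  have hBc : ∀ x κ, ‖Bc x κ‖ ≤ b := norm_insCfg_restr_le hb h69
  have h₀ : AgreeOn (tlo L y j) (thi L y j) U₀ U₀c := (clampCfg_agree U₀).symm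
  have h₁ : AgreeOn (tlo L y j) (thi L y j) (expCfg B) (expCfg Bc) := B7Prop5Flat.agreeOn_expCfg (B7Prop5Flat.agreeOn_insCfg_restr _ _ B)
  have hlamc : ∀ x, AnalyticAt ℂ (fun t => lamc t x) t₀ := fun x => hlam _ (clamp_inBox hlohi x)
  have h207b : ∀ x : Site d, ‖lamc t₀ x‖ < α₄ := fun x => h177b _ (clamp_inBox hlohi x)
  have h207a : ∀ (x : Site d) (κ : Fin d), ‖cj (U₀c x κ) (lamc t₀ (x + e κ)) - lamc t₀ x‖ < α₄ * ((L : ℝ) ^ j)⁻¹ :=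
    h207a_clamp hlohi (by positivity) h177a
  -- `u₁ᶜ ∈ Λ_j(U₀ᶜ, 40d·Lʲb)` globally, and (208) for the extended data
  have hΛ := inLambda_glev_general hL hG hU₀c hα hα3 hα4 h52c hb hBc hsmall hc₃ hs hL1
  have hα2 : 2 * α₀ ≤ c2' d L := by linarith
  have hA := analyticAt_Qnl_of207 hL hG hU₀c hlamc hα hα3 hα2 h52c h207a h207b hΛ (by positivity) hα₃' hs₁ hs₂ hs₃ hs₄ hs₅ hs₆
    m (by omega) z
  -- the two functions of `t` coincide
  have hglev := glev_congr_tower hL1 h₀ h₁ j 0 (by omega)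
  have heq : (fun t => Qnl L U₀ (fun x => expUnit (lam t x)) (glev L hL1 U₀ (expCfg B) j 0) m z)
      = fun t => Qnl L U₀c (fun x => expUnit (lamc t x)) (glev L hL1 U₀c (expCfg Bc) j 0) m z := by
    funext t
    exact Qnl_congr_tower hL1 h₀ (fun x hx hx' => by simp only [hlamc_def, clamp_of_inBox (inBox_of_le hx hx')]) hglev hmn z hz hz'
  rw [heq]
  exact hA

/-- **THE ANALYTICITY OF `C′(λ)` ON THE TOWER, LOCAL HYPOTHESES** (p. 97 «Using the analyticity properties of `C′(λ)`», for B8's region-wise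
data): in the setting of `analyticAt_Qnl_local`, `t ↦ C′_m(u₁, λ(t))(z)` is analytic at `t₀` at every level-`m` site `z ∈ Bⁿ(y)`
((208) minus the linear part `Q′_m`, which is a finite combination of site values on the tower). [cite: Balaban1985RegularSpaces, (1.124) p.97, (1.115) p.96; Balaban1985Averaging, (208) p.50, (213) p.50] -/
theorem analyticAt_Cnl_local (hL : 2 ≤ L) (hG : AvgClosed d L G) (hU₀ : ∀ x κ, U₀ x κ ∈ G)
    (hα : 0 < α₀) (hα3 : C0 d * α₀ ≤ 1 / 3) (hα4 : 4 * α₀ ≤ c2' d L)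
    (h33 : pdevOn (tlo L y j) (thi L y j) U₀ < α₀ * (((L : ℝ) ^ j)⁻¹) ^ 2) (hb : 0 ≤ b)
    (h69 : ∀ (x : Site d) (κ : Fin d), InBox (tlo L y j) (thi L y j) x → InBox (tlo L y j) (thi L y j) (x + e κ) → ‖B x κ‖ ≤ b)
    (hsmall : Real.exp (4 * (800 * ((d : ℝ) + 1) ^ 2 * ((d : ℝ) + 4)) * α₀)
      * (1 + 8 * (131072 * ((d : ℝ) + 1) ^ 2) * ((L : ℝ) ^ j * b)) ≤ 2)
    (hc₃ : 2 * ((L : ℝ) ^ j * b) ≤ c3 d L) (hs : 128 * (d : ℝ) * ((L : ℝ) ^ j * b) ≤ 1) (hL1 : 1 ≤ L)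
    (hlam : ∀ x : Site d, InBox (tlo L y j) (thi L y j) x → AnalyticAt ℂ (fun t => lam t x) t₀)
    (hα₄ : 0 < α₄) (h177b : ∀ x : Site d, InBox (tlo L y j) (thi L y j) x → ‖lam t₀ x‖ < α₄)
    (h177a : ∀ (x : Site d) (κ : Fin d), InBox (tlo L y j) (thi L y j) x → InBox (tlo L y j) (thi L y j) (x + e κ) →
      ‖cj (U₀ x κ) (lam t₀ (x + e κ)) - lam t₀ x‖ < α₄ * ((L : ℝ) ^ j)⁻¹)
    (hα₃' : 40 * d * ((L : ℝ) ^ j * b) ≤ 1 / 50)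
    (hs₁ : 40 * C6 d * α₄ ≤ 1) (hs₂ : 12000 * ((d : ℝ) + 1) * L * α₄ ≤ 1)
    (hs₃ : C4G d L * (α₀ + 40 * d * ((L : ℝ) ^ j * b) + 4 * α₄) ≤ 1)
    (hs₄ : 1024 * ((d : ℝ) + 1) * ((d : ℝ) + 4) * L ^ 2 * α₀ ≤ 1) (hs₅ : 32 * ((d : ℝ) + 1) ^ 2 * C6 d * L ^ 2 * α₀ ≤ 1)
    (hs₆ : 16 * d * C5' d * C6 d * (L : ℝ) ^ 2 * α₀ ≤ 1)
    {m n : ℕ} (hmn : n + m = j) (z : Site d) (hz : tlo L y n ≤ z) (hz' : z ≤ thi L y n) :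
    AnalyticAt ℂ (fun t => Cnl L U₀ (glev L hL1 U₀ (expCfg B) j 0) m (lam t) z) t₀ := by
  have hlohi : ∀ i, tlo L y j i ≤ thi L y j i := B8Ineq130.tlo_le_thi hL1 le_rfl j
  have hQ := analyticAt_Qnl_local hL hG hU₀ hα hα3 hα4 h33 hb h69 hsmall hc₃ hs hL1 hlam hα₄ h177b h177a hα₃' hs₁ hs₂ hs₃ hs₄
    hs₅ hs₆ hmn z hz hz'
  -- the linear part through the clamped family (a finite combination of analytic site values)
  set lamc : E → Site d → 𝔸 := fun t x => lam t (clamp (tlo L y j) (thi L y j) x) with hlamc_def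
  have hlamc : ∀ x, AnalyticAt ℂ (fun t => lamc t x) t₀ := fun x => hlam _ (clamp_inBox hlohi x)
  have hP := B8Eq1123Concrete.analyticAt_QprimeIter_family (zdBlocking d L) (bgT L U₀) hlamc m z
  have heq : (fun t => QprimeIter (zdBlocking d L) (bgT L U₀) m (lam t) z) = fun t => QprimeIter (zdBlocking d L) (bgT L U₀) m (lamc t) z := by
    funext t
    rw [qprimeIter_bgT_eq_lamAvgG, qprimeIter_bgT_eq_lamAvgG]
    exact lamAvgG_congr_tower hL1 (U₀' := U₀) (fun _ _ _ _ => rfl)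
      (fun x hx hx' => by simp only [hlamc_def, clamp_of_inBox (inBox_of_le hx hx')]) m n hmn z hz hz'
  have hP' : AnalyticAt ℂ (fun t => QprimeIter (zdBlocking d L) (bgT L U₀) m (lam t) z) t₀ := by rw [heq]; exact hP
  simp only [Cnl]
  exact hQ.fun_sub hP'

/-! ## §3 … for the inductive `u₁` itself -/

/-- **(208) ON THE TOWER FOR `u₁` ITSELF**: as `analyticAt_Qnl_local`, for any `u₁` bringing `U₁ = e^{B}` to the block axial gauge (1.19) on the
tower under `y` with (1.29) at `y` (B8's inductive `u₁`; `B8Eq106Local.eq106_local`). [cite: Balaban1985RegularSpaces, (1.124) p.97, p.88; Balaban1985Averaging, (208) p.50] -/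
theorem analyticAt_Qnl_local_of_axial (hL : 2 ≤ L) (hG : AvgClosed d L G) (hU₀ : ∀ x κ, U₀ x κ ∈ G)
    (hα : 0 < α₀) (hα3 : C0 d * α₀ ≤ 1 / 3) (hα4 : 4 * α₀ ≤ c2' d L)
    (h33 : pdevOn (tlo L y j) (thi L y j) U₀ < α₀ * (((L : ℝ) ^ j)⁻¹) ^ 2) (hb : 0 ≤ b)
    (h69 : ∀ (x : Site d) (κ : Fin d), InBox (tlo L y j) (thi L y j) x → InBox (tlo L y j) (thi L y j) (x + e κ) → ‖B x κ‖ ≤ b)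
    (hsmall : Real.exp (4 * (800 * ((d : ℝ) + 1) ^ 2 * ((d : ℝ) + 4)) * α₀)
      * (1 + 8 * (131072 * ((d : ℝ) + 1) ^ 2) * ((L : ℝ) ^ j * b)) ≤ 2)
    (hc₃ : 2 * ((L : ℝ) ^ j * b) ≤ c3 d L) (hs : 128 * (d : ℝ) * ((L : ℝ) ^ j * b) ≤ 1) (hL1 : 1 ≤ L)
    (hlam : ∀ x : Site d, InBox (tlo L y j) (thi L y j) x → AnalyticAt ℂ (fun t => lam t x) t₀)
    (hα₄ : 0 < α₄) (h177b : ∀ x : Site d, InBox (tlo L y j) (thi L y j) x → ‖lam t₀ x‖ < α₄)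
    (h177a : ∀ (x : Site d) (κ : Fin d), InBox (tlo L y j) (thi L y j) x → InBox (tlo L y j) (thi L y j) (x + e κ) →
      ‖cj (U₀ x κ) (lam t₀ (x + e κ)) - lam t₀ x‖ < α₄ * ((L : ℝ) ^ j)⁻¹)
    (hα₃' : 40 * d * ((L : ℝ) ^ j * b) ≤ 1 / 50)
    (hs₁ : 40 * C6 d * α₄ ≤ 1) (hs₂ : 12000 * ((d : ℝ) + 1) * L * α₄ ≤ 1)
    (hs₃ : C4G d L * (α₀ + 40 * d * ((L : ℝ) ^ j * b) + 4 * α₄) ≤ 1)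
    (hs₄ : 1024 * ((d : ℝ) + 1) * ((d : ℝ) + 4) * L ^ 2 * α₀ ≤ 1) (hs₅ : 32 * ((d : ℝ) + 1) ^ 2 * C6 d * L ^ 2 * α₀ ≤ 1)
    (hs₆ : 16 * d * C5' d * C6 d * (L : ℝ) ^ 2 * α₀ ≤ 1)
    {u₁ : Site d → 𝔸ˣ}
    (hax : ∀ n, n < j → ∀ z : Site d, Under L (j - (n + 1)) y z → ∀ r : Fin d → Fin L,
      tHol (avgIter L U₀ n) (tildIter L U₀ (mgauge U₀ u₁ (expCfg B)) n) ((L : ℤ) • z) (treeWord (boxVec L r)) = 1)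
    (h129 : uavg L U₀ u₁ j y = 1)
    {m n : ℕ} (hmn : n + m = j) (z : Site d) (hz : tlo L y n ≤ z) (hz' : z ≤ thi L y n) :
    AnalyticAt ℂ (fun t => Qnl L U₀ (fun x => expUnit (lam t x)) u₁ m z) t₀ := by
  have hu : ∀ x : Site d, tlo L y j ≤ x → x ≤ thi L y j → u₁ x = glev L hL1 U₀ (expCfg B) j 0 x := fun x hx hx' =>
    eq106_local L hL1 U₀ (expCfg B) u₁ j y hax h129 x ((under_iff_tower L j y x).2 ⟨hx, hx'⟩)
  have heq : (fun t => Qnl L U₀ (fun x => expUnit (lam t x)) u₁ m z)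
      = fun t => Qnl L U₀ (fun x => expUnit (lam t x)) (glev L hL1 U₀ (expCfg B) j 0) m z := by
    funext t
    exact Qnl_congr_tower hL1 (U₀' := U₀) (fun _ _ _ _ => rfl) (fun _ _ _ => rfl) hu hmn z hz hz'
  rw [heq]
  exact analyticAt_Qnl_local hL hG hU₀ hα hα3 hα4 h33 hb h69 hsmall hc₃ hs hL1 hlam hα₄ h177b h177a hα₃' hs₁ hs₂ hs₃ hs₄ hs₅ hs₆
    hmn z hz hz'

/-- **THE ANALYTICITY OF `C′(λ)` ON THE TOWER FOR `u₁` ITSELF**: as `analyticAt_Cnl_local`, for any `u₁` with (1.19) on the tower and (1.29) at `y`.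
[cite: Balaban1985RegularSpaces, (1.124) p.97, (1.115) p.96, p.88; Balaban1985Averaging, (208) p.50, (213) p.50] -/
theorem analyticAt_Cnl_local_of_axial (hL : 2 ≤ L) (hG : AvgClosed d L G) (hU₀ : ∀ x κ, U₀ x κ ∈ G)
    (hα : 0 < α₀) (hα3 : C0 d * α₀ ≤ 1 / 3) (hα4 : 4 * α₀ ≤ c2' d L)
    (h33 : pdevOn (tlo L y j) (thi L y j) U₀ < α₀ * (((L : ℝ) ^ j)⁻¹) ^ 2) (hb : 0 ≤ b)
    (h69 : ∀ (x : Site d) (κ : Fin d), InBox (tlo L y j) (thi L y j) x → InBox (tlo L y j) (thi L y j) (x + e κ) → ‖B x κ‖ ≤ b)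
    (hsmall : Real.exp (4 * (800 * ((d : ℝ) + 1) ^ 2 * ((d : ℝ) + 4)) * α₀)
      * (1 + 8 * (131072 * ((d : ℝ) + 1) ^ 2) * ((L : ℝ) ^ j * b)) ≤ 2)
    (hc₃ : 2 * ((L : ℝ) ^ j * b) ≤ c3 d L) (hs : 128 * (d : ℝ) * ((L : ℝ) ^ j * b) ≤ 1) (hL1 : 1 ≤ L)
    (hlam : ∀ x : Site d, InBox (tlo L y j) (thi L y j) x → AnalyticAt ℂ (fun t => lam t x) t₀)
    (hα₄ : 0 < α₄) (h177b : ∀ x : Site d, InBox (tlo L y j) (thi L y j) x → ‖lam t₀ x‖ < α₄)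
    (h177a : ∀ (x : Site d) (κ : Fin d), InBox (tlo L y j) (thi L y j) x → InBox (tlo L y j) (thi L y j) (x + e κ) →
      ‖cj (U₀ x κ) (lam t₀ (x + e κ)) - lam t₀ x‖ < α₄ * ((L : ℝ) ^ j)⁻¹)
    (hα₃' : 40 * d * ((L : ℝ) ^ j * b) ≤ 1 / 50)
    (hs₁ : 40 * C6 d * α₄ ≤ 1) (hs₂ : 12000 * ((d : ℝ) + 1) * L * α₄ ≤ 1)
    (hs₃ : C4G d L * (α₀ + 40 * d * ((L : ℝ) ^ j * b) + 4 * α₄) ≤ 1)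
    (hs₄ : 1024 * ((d : ℝ) + 1) * ((d : ℝ) + 4) * L ^ 2 * α₀ ≤ 1) (hs₅ : 32 * ((d : ℝ) + 1) ^ 2 * C6 d * L ^ 2 * α₀ ≤ 1)
    (hs₆ : 16 * d * C5' d * C6 d * (L : ℝ) ^ 2 * α₀ ≤ 1)
    {u₁ : Site d → 𝔸ˣ}
    (hax : ∀ n, n < j → ∀ z : Site d, Under L (j - (n + 1)) y z → ∀ r : Fin d → Fin L,
      tHol (avgIter L U₀ n) (tildIter L U₀ (mgauge U₀ u₁ (expCfg B)) n) ((L : ℤ) • z) (treeWord (boxVec L r)) = 1)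
    (h129 : uavg L U₀ u₁ j y = 1)
    {m n : ℕ} (hmn : n + m = j) (z : Site d) (hz : tlo L y n ≤ z) (hz' : z ≤ thi L y n) :
    AnalyticAt ℂ (fun t => Cnl L U₀ u₁ m (lam t) z) t₀ := by
  have hu : ∀ x : Site d, tlo L y j ≤ x → x ≤ thi L y j → u₁ x = glev L hL1 U₀ (expCfg B) j 0 x := fun x hx hx' =>
    eq106_local L hL1 U₀ (expCfg B) u₁ j y hax h129 x ((under_iff_tower L j y x).2 ⟨hx, hx'⟩)
  have heq : (fun t => Cnl L U₀ u₁ m (lam t) z) = fun t => Cnl L U₀ (glev L hL1 U₀ (expCfg B) j 0) m (lam t) z := by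
    funext t
    exact Cnl_congr_tower hL1 (U₀' := U₀) (fun _ _ _ _ => rfl) hu (fun _ _ _ => rfl) hmn z hz hz'
  rw [heq]
  exact analyticAt_Cnl_local hL hG hU₀ hα hα3 hα4 h33 hb h69 hsmall hc₃ hs hL1 hlam hα₄ h177b h177a hα₃' hs₁ hs₂ hs₃ hs₄ hs₅ hs₆
    hmn z hz hz'

end Analytic

end Literature.MathematicalPhysics.QuantumFieldTheory.Balaban1983to89.B8Eq1124Local

end
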